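import Mathlib.Data.Nat.Factorization.Induction
import Mathlib.Algebra.BigOperators.Finsupp.Basic
import Summits.KontsevichZagierPeriods.KontsevichZagierPeriods.Theorems.HurwitzMicroSectorsNormalFormPrincipleDlogMoves
import Summits.KontsevichZagierPeriods.KontsevichZagierPeriods.Theorems.HurwitzMicroSectorsNormalFormPrincipleSplitAlgebra
import Summits.KontsevichZagierPeriods.KontsevichZagierPeriods.Theorems.HurwitzMicroSectorsNormalFormPrincipleSplitMoves

/-!
# `NormalFormPrinciple` (stmt-KontsevichZagierPeriods-3869), line `SketchIdeator1` — registered stub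
# `box_split_mem_relations` (siege k8: certificate / decide on the finite core)

Pure proof file (`--supports` the crux). It proves the registered sub-goal `box_split_mem_relations`
of the leaf `stub_boxRigidity` BY NAME AND SIGNATURE: **BoxVanishing in dimension one for `ℚ`-split
denominators** — `N = [(0,1), p/q]` (`p, q ∈ ℚ[X]`, `q` a product of rational linear factors,
`q ≠ 0` on `[0,1]`) of value `0` is a relation of the KZ calculus.
Proof (certificate on the finite core): in `FormalRep ⧸ relations` every such `[N]` is brought to
the normal form `[pt, r] + Σ_p Λ(p, C p)` over the prime **carriers** `Λ(n, c) := [(1,n), c/y]`,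
with a certificate `C : ℕ →₀ ℚ` supported on primes (partial fractions `exists_peel_pole`;
Newton–Leibniz over the point for polynomial parts and higher poles; one affine move per simple
pole; scaling/splitting of dlog slabs; unique factorisation `Λ(n,c) = Σ_p Λ(p, v_p(n) c)` by
`induction_on_primes`). Soundness gives `N.value = r + Σ_p (C p) log p`; the finite core
`r = 0 ∧ C = 0` is decided by `eq_zero_of_rat_add_sum_mul_log_prime_eq_zero` (Hermite–Lindemann +
unique factorisation), and the normal form with the zero certificate is `0`. Sources: M. Kontsevich,
D. Zagier, *Periods* (2001), §§1.1–1.2. No definitions (carriers/points are quantified families).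
-/

noncomputable section

open MeasureTheory Set
open scoped Polynomial
open Literature.NumberTheory.Transcendental Literature.NumberTheory.Transcendental.KZ

namespace Summit.KontsevichZagierPeriods.HurwitzMicroSectors.NormalFormPrinciple.PiBox.Dlog

namespace BoxSplitCertificate

/-- `aeval` of a rational polynomial at a rational point, read in `ℝ`. [folklore] -/
theorem aeval_ratCast (x : ℚ) (P : ℚ[X]) : (Polynomial.aeval (x:ℝ) P : ℝ) = ((P.eval x : ℚ) : ℝ) := by
  rw [← eq_ratCast (algebraMap ℚ ℝ) (P.eval x), ← Polynomial.aeval_algebraMap_apply_eq_algebraMap_eval,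
    eq_ratCast]

/-- A family of dlog representations `R a b c = [(a,b), c/y]` (`0 < a`). [cite: KontsevichZagier2001, §1.1] -/
theorem exists_carrierFamily : ∃ R : ℚ → ℚ → ℚ → IntegralRep 1, ∀ a b c, 0 < a →
    (R a b c).domain = {x | x 0 ∈ Set.Ioo (a:ℝ) b} ∧ (R a b c).integrand = fun x => (c:ℝ) / x 0 := by
  classical
  obtain ⟨L₀, -⟩ := exists_dlog 1 1 0 one_pos
  refine ⟨fun a b c => if h : 0 < a then Classical.choose (exists_dlog a b c h) else L₀,
    fun a b c h => ?_⟩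
  simp only [dif_pos h]
  exact Classical.choose_spec (exists_dlog a b c h)

/-- `[pt, r + r'] = [pt, r] + [pt, r']` modulo relations. [cite: KontsevichZagier2001, §1.2 rule (1)] -/
theorem mk_pt_add {Z : ℚ → IntegralRep 0} (hZ : ∀ r, (Z r).domain = univ ∧ (Z r).integrand = fun _ => (r:ℝ))
    (r r' : ℚ) : QuotientAddGroup.mk' relations (of (Z (r + r'))) =
      QuotientAddGroup.mk' relations (of (Z r)) + QuotientAddGroup.mk' relations (of (Z r')) := by
  have h := pt_add_mem_relations (Z (r + r')) (Z r) (Z r') (hZ _).1 (hZ _).1 (hZ _).1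
    (by rw [(hZ _).2]; push_cast; rfl) (hZ _).2 (hZ _).2
  rwa [← map_add, QuotientAddGroup.mk'_apply, QuotientAddGroup.mk'_apply,
    QuotientAddGroup.eq_iff_sub_mem, sub_add_eq_sub_sub]

/-- `[pt, 0] = 0` modulo relations. [cite: KontsevichZagier2001, §1.2 rule (1)] -/
theorem mk_pt_zero {Z : ℚ → IntegralRep 0} (hZ : ∀ r, (Z r).domain = univ ∧ (Z r).integrand = fun _ => (r:ℝ)) :
    QuotientAddGroup.mk' relations (of (Z 0)) = 0 := by
  rw [QuotientAddGroup.mk'_apply, QuotientAddGroup.eq_zero_iff]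
  exact pt_zero_mem_relations (Z 0) (by rw [(hZ 0).2]; push_cast; rfl)

section Carriers

variable {R : ℚ → ℚ → ℚ → IntegralRep 1}
  (hR : ∀ a b c, 0 < a → (R a b c).domain = {x | x 0 ∈ Set.Ioo (a:ℝ) b} ∧
    (R a b c).integrand = fun x => (c:ℝ) / x 0)
include hR

/-- Additivity of carriers in the coefficient (rule 1b). [cite: KontsevichZagier2001, §1.2 rule (1)] -/
theorem mk_carrier_add {a : ℚ} (b c c' : ℚ) (ha : 0 < a) :
    QuotientAddGroup.mk' relations (of (R a b (c + c'))) =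
      QuotientAddGroup.mk' relations (of (R a b c)) + QuotientAddGroup.mk' relations (of (R a b c')) := by
  have h := dlog_merge_mem_relations (R a b (c + c')) (R a b c) (R a b c') (hR a b _ ha).1
    (hR a b _ ha).1 (hR a b _ ha).1 (by rw [(hR a b _ ha).2]; exact fun _ _ => rfl)
    (by rw [(hR a b _ ha).2]; exact fun _ _ => rfl) (by rw [(hR a b _ ha).2]; exact fun _ _ => rfl)
  rwa [← map_add, QuotientAddGroup.mk'_apply, QuotientAddGroup.mk'_apply,
    QuotientAddGroup.eq_iff_sub_mem, sub_add_eq_sub_sub]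

/-- The zero carrier `[(a,b), 0/y]` is `0` modulo relations. [cite: KontsevichZagier2001, §1.2] -/
theorem mk_carrier_zero {a : ℚ} (b : ℚ) (ha : 0 < a) : QuotientAddGroup.mk' relations (of (R a b 0)) = 0 := by
  rw [QuotientAddGroup.mk'_apply, QuotientAddGroup.eq_zero_iff]
  exact dlog_zero_mem_relations (R a b 0) (by rw [(hR a b 0 ha).2]; exact fun _ _ => rfl)

/-- `Λ(a, −c) = −Λ(a, c)` for the carriers. [cite: KontsevichZagier2001, §1.2 rule (1)] -/
theorem mk_carrier_neg {a : ℚ} (b c : ℚ) (ha : 0 < a) :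
    QuotientAddGroup.mk' relations (of (R a b (-c))) = -QuotientAddGroup.mk' relations (of (R a b c)) := by
  refine eq_neg_of_add_eq_zero_left ?_
  rw [← mk_carrier_add hR b (-c) c ha, neg_add_cancel, mk_carrier_zero hR b ha]

/-- **Multiplicativity of the carriers** `Λ(mn, c) = Λ(m, c) + Λ(n, c)` (`m, n ≥ 1`): split
`(1, mn)` at `m` and rescale `(m, mn)` to `(1, n)`. [cite: KontsevichZagier2001, §1.2 rules (1), (2)] -/
theorem mk_carrier_mul (m n : ℕ) (hm : 1 ≤ m) (hn : 1 ≤ n) (c : ℚ) :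
    QuotientAddGroup.mk' relations (of (R 1 ((m * n : ℕ) : ℚ) c)) =
      QuotientAddGroup.mk' relations (of (R 1 m c)) + QuotientAddGroup.mk' relations (of (R 1 n c)) := by
  have hm0 : (0:ℚ) < m := by exact_mod_cast hm
  obtain ⟨hdL, hiL⟩ := hR 1 ((m * n : ℕ) : ℚ) c one_pos
  obtain ⟨hdA, hiA⟩ := hR 1 (m : ℚ) c one_pos
  obtain ⟨hdB, hiB⟩ := hR (m : ℚ) ((m * n : ℕ) : ℚ) c hm0
  obtain ⟨hdN, hiN⟩ := hR 1 (n : ℚ) c one_pos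
  have h1 : of (R 1 ((m * n : ℕ) : ℚ) c) - of (R 1 m c) - of (R m ((m * n : ℕ) : ℚ) c) ∈ relations :=
    split_mem_relations _ _ _ hdL hdA hdB (by exact_mod_cast hm)
      (by exact_mod_cast Nat.le_mul_of_pos_right m hn) (fun x _ => by rw [hiA, hiL])
      (fun x _ => by rw [hiB, hiL])
  have h2 : of (R 1 (n:ℚ) c) - of (R m ((m * n : ℕ) : ℚ) c) ∈ relations :=
    dlog_scale_mem_relations (s := (m:ℚ)) (a := 1) (b := (n:ℚ)) _ _ hdN
      (by rw [hdB]; push_cast; simp only [mul_one]) (fun x _ => by rw [hiN]) (fun x _ => by rw [hiB])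
      one_pos hm0
  rw [← map_add, QuotientAddGroup.mk'_apply, QuotientAddGroup.mk'_apply, QuotientAddGroup.eq_iff_sub_mem]
  have : of (R 1 ((m * n : ℕ) : ℚ) c) - (of (R 1 (m:ℚ) c) + of (R 1 (n:ℚ) c)) =
      (of (R 1 ((m * n : ℕ) : ℚ) c) - of (R 1 m c) - of (R m ((m * n : ℕ) : ℚ) c)) -
        (of (R 1 (n:ℚ) c) - of (R m ((m * n : ℕ) : ℚ) c)) := by abel
  rw [this]
  exact relations.sub_mem h1 h2

/-- **Unique factorisation on the carriers**: `Λ(n, c) = Σ_p Λ(p, v_p(n)·c)` for `n ≥ 1`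
(`Λ(1, c)` is an empty slab). [folklore] -/
theorem mk_carrier_eq_factorization_sum (c : ℚ) : ∀ n : ℕ, n ≠ 0 →
    QuotientAddGroup.mk' relations (of (R 1 n c)) =
      n.factorization.sum fun p k => QuotientAddGroup.mk' relations (of (R 1 p ((k:ℚ) * c))) := by
  refine induction_on_primes (fun h => (h rfl).elim) (fun _ => ?_) (fun p a hp ih hpa => ?_)
  · rw [Nat.factorization_one, Finsupp.sum_zero_index, Nat.cast_one, QuotientAddGroup.mk'_apply,
      QuotientAddGroup.eq_zero_iff]
    exact slab_empty_mem_relations (R 1 1 c) (hR 1 1 c one_pos).1 (by exact_mod_cast le_rfl)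
  · have ha : a ≠ 0 := fun h => hpa (by rw [h, mul_zero])
    rw [mk_carrier_mul hR p a hp.one_lt.le (Nat.one_le_iff_ne_zero.mpr ha), ih ha,
      Nat.factorization_mul hp.ne_zero ha, hp.factorization,
      Finsupp.sum_add_index' (fun q => ?_) (fun q k₁ k₂ => ?_), Finsupp.sum_single_index ?_]
    · rw [Nat.cast_one, one_mul]
    · rw [Nat.cast_zero, zero_mul]; exact mk_carrier_zero hR _ one_pos
    · rw [Nat.cast_zero, zero_mul]; exact mk_carrier_zero hR _ one_pos
    · rw [Nat.cast_add, add_mul]; exact mk_carrier_add hR _ _ _ one_pos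

end Carriers

section NormalForm

variable {R : ℚ → ℚ → ℚ → IntegralRep 1}
  (hR : ∀ a b c, 0 < a → (R a b c).domain = {x | x 0 ∈ Set.Ioo (a:ℝ) b} ∧
    (R a b c).integrand = fun x => (c:ℝ) / x 0)
  {Z : ℚ → IntegralRep 0} (hZ : ∀ r, (Z r).domain = univ ∧ (Z r).integrand = fun _ => (r:ℝ))
include hR hZ

/-- Normal forms `[pt, r] + Σ_p Λ(p, C p)` (certificate `C : ℕ →₀ ℚ` on primes) add. [folklore] -/
theorem nf_add {x y : FormalRep ⧸ relations}
    (hx : ∃ (r : ℚ) (C : ℕ →₀ ℚ), (∀ p ∈ C.support, p.Prime) ∧ x = QuotientAddGroup.mk' relations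
      (of (Z r)) + C.sum fun p a => QuotientAddGroup.mk' relations (of (R 1 p a)))
    (hy : ∃ (r : ℚ) (C : ℕ →₀ ℚ), (∀ p ∈ C.support, p.Prime) ∧ y = QuotientAddGroup.mk' relations
      (of (Z r)) + C.sum fun p a => QuotientAddGroup.mk' relations (of (R 1 p a))) :
    ∃ (r : ℚ) (C : ℕ →₀ ℚ), (∀ p ∈ C.support, p.Prime) ∧ x + y = QuotientAddGroup.mk' relations
      (of (Z r)) + C.sum fun p a => QuotientAddGroup.mk' relations (of (R 1 p a)) := by
  obtain ⟨r, C, hC, rfl⟩ := hx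
  obtain ⟨r', C', hC', rfl⟩ := hy
  refine ⟨r + r', C + C', fun p hp => ?_, ?_⟩
  · rcases Finset.mem_union.mp (Finsupp.support_add hp) with h | h
    exacts [hC p h, hC' p h]
  · rw [mk_pt_add hZ, Finsupp.sum_add_index' (fun p => mk_carrier_zero hR _ one_pos)
      (fun p a b => mk_carrier_add hR _ _ _ one_pos)]
    abel

/-- A carrier `Λ(n, c)`, `n ≥ 1`, is in normal form (certificate `p ↦ v_p(n)·c`). [folklore] -/
theorem nf_carrier (n : ℕ) (hn : n ≠ 0) (c : ℚ) :
    ∃ (r : ℚ) (C : ℕ →₀ ℚ), (∀ p ∈ C.support, p.Prime) ∧ QuotientAddGroup.mk' relations (of (R 1 n c)) =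
      QuotientAddGroup.mk' relations (of (Z r)) + C.sum fun p a => QuotientAddGroup.mk' relations (of (R 1 p a)) := by
  refine ⟨0, Finsupp.mapRange (fun k : ℕ => (k:ℚ) * c) (by simp) n.factorization, fun p hp =>
    Nat.prime_of_mem_primeFactors (Finsupp.support_mapRange hp), ?_⟩
  rw [mk_pt_zero hZ, zero_add, Finsupp.sum_mapRange_index fun p => mk_carrier_zero hR _ one_pos]
  exact mk_carrier_eq_factorization_sum hR c n hn

/-- **A dlog slab `[(a,b), c/y]` (`0 < a < b` rational) is in normal form**: rescale by
`s = a.den · b.den` to natural ends `(A, B) = (s a, s b)` (rule 2) and split `(1,B)` at `A` (rule 1a),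
so that `[L] = Λ(B, c) + Λ(A, −c)`. [cite: KontsevichZagier2001, §1.2 rules (1), (2)] -/
theorem nf_dlog {a b c : ℚ} (ha : 0 < a) (hab : a < b) (L : IntegralRep 1)
    (hd : L.domain = {x | x 0 ∈ Set.Ioo (a:ℝ) b}) (hi : EqOn L.integrand (fun x => (c:ℝ) / x 0) L.domain) :
    ∃ (r : ℚ) (C : ℕ →₀ ℚ), (∀ p ∈ C.support, p.Prime) ∧ QuotientAddGroup.mk' relations (of L) =
      QuotientAddGroup.mk' relations (of (Z r)) + C.sum fun p a => QuotientAddGroup.mk' relations (of (R 1 p a)) := by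
  -- the certificate: natural ends `A = s a`, `B = s b` with `s = a.den * b.den`
  obtain ⟨s, A, B, hs, hsa, hsb⟩ : ∃ s A B : ℕ, 0 < s ∧ (s:ℚ) * a = A ∧ (s:ℚ) * b = B := by
    refine ⟨a.den * b.den, b.den * a.num.natAbs, a.den * b.num.natAbs,
      Nat.mul_pos a.den_pos b.den_pos, ?_, ?_⟩
    · have h1 : ((a.num.natAbs : ℕ) : ℚ) = a.num := by
        rw [← Int.cast_natCast, Int.natAbs_of_nonneg (Rat.num_nonneg.mpr ha.le)]
      push_cast; rw [h1, mul_comm (a.den : ℚ), mul_assoc, Rat.den_mul_eq_num]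
    · have h1 : ((b.num.natAbs : ℕ) : ℚ) = b.num := by
        rw [← Int.cast_natCast, Int.natAbs_of_nonneg (Rat.num_nonneg.mpr (ha.trans hab).le)]
      push_cast; rw [h1, mul_assoc, Rat.den_mul_eq_num]
  have hA0 : (0:ℚ) < A := by rw [← hsa]; positivity
  have hAB : A < B := by
    have : (A:ℚ) < B := by rw [← hsa, ← hsb]; exact mul_lt_mul_of_pos_left hab (by exact_mod_cast hs)
    exact_mod_cast this
  obtain ⟨hdAB, hiAB⟩ := hR A B c hA0
  obtain ⟨hd1B, hi1B⟩ := hR 1 B c one_pos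
  obtain ⟨hd1A, hi1A⟩ := hR 1 A c one_pos
  have h1 : of L - of (R A B c) ∈ relations :=
    dlog_scale_mem_relations (s := (s:ℚ)) L (R A B c) hd (by rw [hsa, hsb]; exact hdAB) hi
      (fun x _ => by rw [hiAB]) ha (by exact_mod_cast hs)
  have h2 : of (R 1 B c) - of (R 1 A c) - of (R A B c) ∈ relations :=
    split_mem_relations (R 1 B c) (R 1 A c) (R A B c) hd1B hd1A hdAB (by exact_mod_cast hA0)
      (by exact_mod_cast hAB.le) (fun x _ => by rw [hi1A, hi1B]) (fun x _ => by rw [hiAB, hi1B])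
  have hL : QuotientAddGroup.mk' relations (of L) = QuotientAddGroup.mk' relations (of (R 1 B c)) +
      QuotientAddGroup.mk' relations (of (R 1 A (-c))) := by
    rw [mk_carrier_neg hR _ _ one_pos, ← sub_eq_add_neg, ← map_sub, QuotientAddGroup.mk'_apply,
      QuotientAddGroup.mk'_apply, QuotientAddGroup.eq_iff_sub_mem]
    have : of L - (of (R 1 B c) - of (R 1 A c)) =
        (of L - of (R A B c)) - (of (R 1 B c) - of (R 1 A c) - of (R A B c)) := by abel
    rw [this]
    exact relations.sub_mem h1 h2
  have hA1 : 1 ≤ A := by exact_mod_cast hA0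
  rw [hL]
  exact nf_add hR hZ (nf_carrier hR hZ B (by omega) c) (nf_carrier hR hZ A (by omega) (-c))

/-- **A simple rational pole `[(0,1), c/(x − ρ)]`, `ρ ∉ [0,1]`, is in normal form**: one affine
move (rule 2; `y = x − ρ` if `ρ < 0`, `y = ρ − x` if `ρ > 1`) onto a dlog slab `[(a, a+1), c'/y]`
with positive rational ends. [cite: KontsevichZagier2001, §1.2 rule (2)] -/
theorem nf_pole {c ρ : ℚ} (hρ : (ρ:ℝ) ∉ Set.Icc (0:ℝ) 1) (T : IntegralRep 1)
    (hTd : T.domain = {x | x 0 ∈ Set.Ioo (0:ℝ) 1}) (hTi : EqOn T.integrand (fun x => (c:ℝ) / (x 0 - ρ)) T.domain) :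
    ∃ (r : ℚ) (C : ℕ →₀ ℚ), (∀ p ∈ C.support, p.Prime) ∧ QuotientAddGroup.mk' relations (of T) =
      QuotientAddGroup.mk' relations (of (Z r)) + C.sum fun p a => QuotientAddGroup.mk' relations (of (R 1 p a)) := by
  simp only [Set.mem_Icc, not_and_or, not_le] at hρ
  -- the affine move `y = s x + t` onto the slab `(a, a + 1)`, new coefficient `c'`
  obtain ⟨s, t, a, c', hs, ha, himg, hint⟩ : ∃ s t a c' : ℚ, s ≠ 0 ∧ 0 < a ∧
      {x : Fin 1 → ℝ | x 0 ∈ Set.Ioo (a:ℝ) ((a + 1 : ℚ):ℝ)} =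
        (fun y : Fin 1 → ℝ => fun _ : Fin 1 => (s:ℝ) * y 0 + t) '' T.domain ∧
      EqOn T.integrand (fun x => (c':ℝ) / ((s:ℝ) * x 0 + t) * |(s:ℝ)|) T.domain := by
    rcases hρ with hneg | hbig
    · refine ⟨1, -ρ, -ρ, c, one_ne_zero, neg_pos.mpr (by exact_mod_cast hneg), ?_, fun x hx => ?_⟩
      · rw [hTd, image_affine_slab_of_pos (by exact_mod_cast one_pos)]
        ext x; simp only [Set.mem_setOf_eq, Set.mem_Ioo]; push_cast
        constructor <;> rintro ⟨h1, h2⟩ <;> constructor <;> linarith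
      · rw [hTi hx]; push_cast; rw [abs_one, mul_one, one_mul, sub_eq_add_neg]
    · refine ⟨-1, ρ, ρ - 1, -c, by norm_num, sub_pos.mpr (by exact_mod_cast hbig), ?_, fun x hx => ?_⟩
      · rw [hTd, image_affine_slab_of_neg (by exact_mod_cast (by norm_num : (-1:ℚ) < 0))]
        ext x; simp only [Set.mem_setOf_eq, Set.mem_Ioo]; push_cast
        constructor <;> rintro ⟨h1, h2⟩ <;> constructor <;> linarith
      · rw [hTi hx]; push_cast
        rw [abs_neg, abs_one, mul_one, show (-1:ℝ) * x 0 + ρ = -(x 0 - ρ) by ring, neg_div_neg_eq]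
  obtain ⟨hdL, hiL⟩ := hR a (a + 1) c' ha
  have h : of T - of (R a (a + 1) c') ∈ relations :=
    affine_sub_mem_relations hs T (R a (a + 1) c') (fun y => (c':ℝ) / y) (hdL.trans himg)
      (fun x _ => by rw [hiL]) hint
  have hT : QuotientAddGroup.mk' relations (of T) = QuotientAddGroup.mk' relations (of (R a (a + 1) c')) := by
    rwa [QuotientAddGroup.mk'_apply, QuotientAddGroup.mk'_apply, QuotientAddGroup.eq_iff_sub_mem]
  rw [hT]
  exact nf_dlog hR hZ ha (by linarith) _ hdL (by rw [hiL]; exact fun _ _ => rfl)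

omit hR in
/-- **Newton–Leibniz over the point** (rule 3): `[(0,1), f]` with a `ℚ`-rational primitive `P_F/Q_F`
of `f` is `[pt, F(1) − F(0)]`, a normal form with zero certificate. [cite: KontsevichZagier2001, §1.2 rule (3)] -/
theorem nf_of_primitive (f : ℝ → ℝ) (PF QF : ℚ[X]) (hQF : ∀ t ∈ Set.Icc (0:ℝ) 1, (Polynomial.aeval t QF : ℝ) ≠ 0)
    (hderiv : ∀ t ∈ Set.Ioo (0:ℝ) 1,
      HasDerivAt (fun u : ℝ => (Polynomial.aeval u PF : ℝ) / Polynomial.aeval u QF) (f t) t)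
    (hf : IsSemialgebraicFunOn ℚ {x : Fin 1 → ℝ | x 0 ∈ Set.Icc (0:ℝ) 1} (fun x => f (x 0)))
    (T : IntegralRep 1) (hTd : T.domain = {x | x 0 ∈ Set.Ioo (0:ℝ) 1})
    (hTi : EqOn T.integrand (fun x => f (x 0)) T.domain) :
    ∃ (r : ℚ) (C : ℕ →₀ ℚ), (∀ p ∈ C.support, p.Prime) ∧ QuotientAddGroup.mk' relations (of T) =
      QuotientAddGroup.mk' relations (of (Z r)) + C.sum fun p a => QuotientAddGroup.mk' relations (of (R 1 p a)) := by
  set r : ℚ := PF.eval 1 / QF.eval 1 - PF.eval 0 / QF.eval 0 with hr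
  have e0 : ((0:ℚ):ℝ) = 0 := Rat.cast_zero
  have e1 : ((1:ℚ):ℝ) = 1 := Rat.cast_one
  have h := slab_sub_pt_mem_relations (α := 0) (β := 1) zero_le_one f PF QF (by rw [e0, e1]; exact hQF)
    (by rw [e0, e1]; exact hderiv) (by rw [e0, e1]; exact hf) T (by rw [e0, e1]; exact hTd) hTi (Z r)
    (hZ r).1 (by rw [(hZ r).2, aeval_ratCast, aeval_ratCast, aeval_ratCast, aeval_ratCast, hr]; push_cast; ring_nf)
  refine ⟨r, 0, by simp, ?_⟩
  rwa [Finsupp.sum_zero_index, add_zero, QuotientAddGroup.mk'_apply, QuotientAddGroup.mk'_apply,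
    QuotientAddGroup.eq_iff_sub_mem]

/-- **Reduction to normal form** of `[(0,1), p/q]` for a `ℚ`-split `q ≠ 0` on `[0,1]`, by induction
on `deg q`: peel a rational pole (`exists_peel_pole`, rule 1b), treat the simple pole by `nf_pole`,
higher poles and the final polynomial by `nf_of_primitive`. [cite: KontsevichZagier2001, §1.2] -/
theorem nf_rat (d : ℕ) : ∀ (q : ℚ[X]), q.natDegree = d → q ≠ 0 → q.Splits →
    (∀ t ∈ Set.Icc (0:ℝ) 1, (Polynomial.aeval t q : ℝ) ≠ 0) → ∀ (p : ℚ[X]) (T : IntegralRep 1),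
    T.domain = {x | x 0 ∈ Set.Ioo (0:ℝ) 1} →
    EqOn T.integrand (fun x => (Polynomial.aeval (x 0) p : ℝ) / Polynomial.aeval (x 0) q) T.domain →
    ∃ (r : ℚ) (C : ℕ →₀ ℚ), (∀ p ∈ C.support, p.Prime) ∧ QuotientAddGroup.mk' relations (of T) =
      QuotientAddGroup.mk' relations (of (Z r)) + C.sum fun p a => QuotientAddGroup.mk' relations (of (R 1 p a)) := by
  induction d using Nat.strong_induction_on with
  | _ d ih =>
  intro q hdeg hq hsplit hq01 p T hTd hTi
  have hIcc : Literature.ModelTheory.ExponentialFields.IsSemialgebraic ℚ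
      {x : Fin 1 → ℝ | x 0 ∈ Set.Icc (0:ℝ) 1} := by simpa using isSemialgebraic_Icc₁ 0 1
  rcases Nat.eq_zero_or_pos d with hd0 | hdpos
  · -- `q` is a non-zero constant: polynomial integrand, polynomial primitive
    set q₀ : ℚ := q.coeff 0 with hq₀
    have hqC : q = Polynomial.C q₀ := Polynomial.eq_C_of_natDegree_eq_zero (hdeg.trans hd0)
    obtain ⟨G, hG⟩ := exists_polynomial_hasDerivAt (Polynomial.C q₀⁻¹ * p)
    refine nf_of_primitive hZ (fun t => (Polynomial.aeval t p : ℝ) / Polynomial.aeval t q) G 1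
      (fun t _ => by simp) (fun t _ => ?_)
      (isSemialgebraicFunOn_polynomial_div hIcc p q fun x hx => hq01 _ hx) T hTd hTi
    have e : (fun u : ℝ => (Polynomial.aeval u G : ℝ) / Polynomial.aeval u (1 : ℚ[X])) =
        fun u => (Polynomial.aeval u G : ℝ) := by funext u; simp
    have hqt : (Polynomial.aeval t q : ℝ) = q₀ := by rw [hqC]; simp
    rw [e, hqt]
    convert hG t using 1
    simp [div_eq_inv_mul]
  · -- peel one rational pole `ρ` of `q`
    have hdeg0 : q.degree ≠ 0 := by
      rw [Polynomial.degree_eq_natDegree hq, hdeg]; exact_mod_cast hdpos.ne'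
    obtain ⟨ρ, hρ⟩ := hsplit.exists_eval_eq_zero hdeg0
    obtain ⟨k, c, p₁, q₁, hq₁0, hdeg₁, hdvd, hpeel⟩ := exists_peel_pole p q hq hρ
    have hρ01 : (ρ:ℝ) ∉ Set.Icc (0:ℝ) 1 := fun h => hq01 _ h (by rw [aeval_ratCast, hρ, Rat.cast_zero])
    have hne : ∀ t ∈ Set.Icc (0:ℝ) 1, t - ρ ≠ 0 := fun t ht h => hρ01 (by rwa [← sub_eq_zero.mp h])
    have hq₁01 : ∀ t ∈ Set.Icc (0:ℝ) 1, (Polynomial.aeval t q₁ : ℝ) ≠ 0 := fun t ht h => by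
      obtain ⟨w, hw⟩ := hdvd; exact hq01 t ht (by rw [hw, map_mul, h, zero_mul])
    have hpow : ∀ (j : ℕ), ∀ t ∈ Set.Icc (0:ℝ) 1,
        (Polynomial.aeval t ((Polynomial.X - Polynomial.C ρ) ^ j) : ℝ) ≠ 0 := fun j t ht => by
      simpa using pow_ne_zero j (hne t ht)
    -- the two summands `[(0,1), c/(x−ρ)^{k+1}]` and `[(0,1), p₁/q₁]` (rule 1b)
    obtain ⟨T₁, hT₁d, hT₁i⟩ :=
      exists_rep_unit (Polynomial.C c) ((Polynomial.X - Polynomial.C ρ) ^ (k + 1)) (hpow (k + 1))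
    obtain ⟨T₂, hT₂d, hT₂i⟩ := exists_rep_unit p₁ q₁ hq₁01
    have hadd : of T - of T₁ - of T₂ ∈ relations := by
      refine integrandAddRel_subset_relations ⟨1, T, T₁, T₂, hT₁d.trans hTd.symm,
        hT₂d.trans hTd.symm, fun x hx => ?_, rfl⟩
      rw [Pi.add_apply, hTi hx, hT₁i, hT₂i]
      have hx' : x 0 ∈ Set.Icc (0:ℝ) 1 := Set.Ioo_subset_Icc_self (by rw [hTd] at hx; exact hx)
      simp only [map_pow, map_sub, Polynomial.aeval_X, Polynomial.aeval_C, eq_ratCast]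
      exact hpeel (x 0) (hq01 _ hx')
    have hT : QuotientAddGroup.mk' relations (of T) = QuotientAddGroup.mk' relations (of T₁) +
        QuotientAddGroup.mk' relations (of T₂) := by
      rwa [← map_add, QuotientAddGroup.mk'_apply, QuotientAddGroup.mk'_apply,
        QuotientAddGroup.eq_iff_sub_mem, sub_add_eq_sub_sub]
    rw [hT]
    refine nf_add hR hZ ?_ (ih q₁.natDegree (hdeg ▸ hdeg₁) q₁ rfl hq₁0 (hsplit.of_dvd hq hdvd) hq₁01
      p₁ T₂ hT₂d (by rw [hT₂i]; exact fun _ _ => rfl))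
    cases k with
    | zero => -- simple pole
      refine nf_pole hR hZ (c := c) hρ01 T₁ hT₁d fun x _ => ?_
      rw [hT₁i]
      simp only [map_sub, Polynomial.aeval_X, Polynomial.aeval_C, eq_ratCast, zero_add, pow_one]
    | succ j => -- higher pole: primitive `a/(u − ρ)^{j+1}`, `a = −c/(j+1)`
      set a : ℚ := -c / (j + 1) with ha
      refine nf_of_primitive hZ (fun t => (c:ℝ) / (t - ρ) ^ (j + 2)) (Polynomial.C a)
        ((Polynomial.X - Polynomial.C ρ) ^ (j + 1)) (hpow (j + 1)) (fun t ht => ?_)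
        ((isSemialgebraicFunOn_polynomial_div hIcc (Polynomial.C c)
          ((Polynomial.X - Polynomial.C ρ) ^ (j + 2)) (fun x hx => hpow (j + 2) _ hx)).congr
          fun x _ => by simp) T₁ hT₁d fun x _ => ?_
      · have e : (fun u : ℝ => (Polynomial.aeval u (Polynomial.C a) : ℝ) /
            Polynomial.aeval u ((Polynomial.X - Polynomial.C ρ) ^ (j + 1))) =
            fun u => (a:ℝ) / (u - ρ) ^ (j + 1) := by funext u; simp
        rw [e]
        convert hasDerivAt_const_div_pow (a:ℝ) ρ j (hne t (Set.Ioo_subset_Icc_self ht)) using 1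
        have hj : ((j:ℝ) + 1) ≠ 0 := by positivity
        rw [ha]; push_cast
        field_simp
      · rw [hT₁i]; simp

omit hZ in
/-- **Value of a normal form** (soundness of the calculus, `∫₁^p c dy/y = c log p`):
`N.value = r + Σ_p (C p) log p`. [cite: KontsevichZagier2001, §1.2] -/
theorem value_eq_of_nf {n : ℕ} (N : IntegralRep n) {r : ℚ} {C : ℕ →₀ ℚ}
    (hZ : ∀ r, (Z r).domain = univ ∧ (Z r).integrand = fun _ => (r:ℝ)) (hC : ∀ p ∈ C.support, p.Prime)
    (h : QuotientAddGroup.mk' relations (of N) = QuotientAddGroup.mk' relations (of (Z r)) +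
      C.sum fun p a => QuotientAddGroup.mk' relations (of (R 1 p a))) :
    N.value = r + C.sum fun p a => (a:ℝ) * Real.log p := by
  have h' : of N - (of (Z r) + C.sum fun p a => of (R 1 p a)) ∈ relations := by
    rw [← QuotientAddGroup.ker_mk' relations, AddMonoidHom.mem_ker, map_sub, map_add, map_finsuppSum,
      h, sub_self]
  have he := relations_le_ker_eval_holds h'
  rw [AddMonoidHom.mem_ker, map_sub, map_add, map_finsuppSum, eval_of, eval_of, sub_eq_zero] at he
  rw [he, value_pt (Z r) (hZ r).1 (hZ r).2]
  congr 1
  refine Finsupp.sum_congr fun p hp => ?_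
  rw [eval_of, value_dlog (R 1 p (C p)) (hR 1 p _ one_pos).1
    (by rw [(hR 1 p _ one_pos).2]; exact fun _ _ => rfl) one_pos (by exact_mod_cast (hC p hp).one_lt.le)]
  push_cast; rw [div_one]

end NormalForm

/-- **Stub `box_split_mem_relations`** (registered sub-goal of crux stmt-KontsevichZagierPeriods-3869,
line `SketchIdeator1`, split-denominator layer of `stub_boxRigidity`): BoxVanishing in dimension
one for `ℚ`-split denominators. If `N = [(0,1), p/q]` with `p, q ∈ ℚ[X]`, `q ≠ 0` splitting over
`ℚ` and non-vanishing on `[0,1]`, and `N.value = 0`, then `[N] ∈ KZ.relations`. Proof: normal form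
`[N] = [pt, r] + Σ_p Λ(p, C p)` (`nf_rat`), value `r + Σ_p (C p) log p = 0` (`value_eq_of_nf`),
finite core `r = 0 ∧ C = 0` (`eq_zero_of_rat_add_sum_mul_log_prime_eq_zero`), and the zero normal
form is a relation. [cite: KontsevichZagier2001, §1.2 Conjecture 1 (this sub-family)] -/
theorem box_split_mem_relations (p q : ℚ[X]) (hq : q ≠ 0) (hsplit : q.Splits)
    (hq01 : ∀ t ∈ Set.Icc (0:ℝ) 1, (Polynomial.aeval t q : ℝ) ≠ 0) (N : IntegralRep 1)
    (hNd : N.domain = {x | x 0 ∈ Set.Ioo (0:ℝ) 1})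
    (hNi : EqOn N.integrand (fun x => (Polynomial.aeval (x 0) p : ℝ) / Polynomial.aeval (x 0) q) N.domain)
    (hv : N.value = 0) : of N ∈ relations := by
  obtain ⟨R, hR⟩ := exists_carrierFamily
  obtain ⟨Z, hZ⟩ := exists_ptCarrier
  obtain ⟨r, C, hC, hNF⟩ := nf_rat hR hZ q.natDegree q rfl hq hsplit hq01 p N hNd hNi
  have hval := value_eq_of_nf hR N hZ hC hNF
  rw [hv, Finsupp.sum] at hval
  -- the finite core, decided by Hermite–Lindemann + unique factorisation
  obtain ⟨hr0, hC0⟩ := eq_zero_of_rat_add_sum_mul_log_prime_eq_zero hC r C hval.symm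
  have hC' : C = 0 := Finsupp.ext fun s => by_contra fun hne =>
    hne (hC0 s (Finsupp.mem_support_iff.mpr hne))
  rw [hr0, hC', Finsupp.sum_zero_index, add_zero, mk_pt_zero hZ, QuotientAddGroup.mk'_apply,
    QuotientAddGroup.eq_zero_iff] at hNF
  exact hNF

end BoxSplitCertificate

end Summit.KontsevichZagierPeriods.HurwitzMicroSectors.NormalFormPrinciple.PiBox.Dlog
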